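import Summits.BirchSwinnertonDyer.Rank1Residual.Additive.X3RankZeroCyclotomicThreeFacts
import Summits.BirchSwinnertonDyer.Rank1Residual.Additive.X3RankZeroCyclotomicThreeUnitRowsNoMilne
import HarnessLib

/-!
# Line V14 at Facts level (X3 at `p = 3` over `K = ℚ(ζ₃)`, ranks `(0,0)`: Wuthrich Thm. 16 + Greenberg Thm. 4.1 from named facts; UPPER half + doubly-unit ENDs) — Milne's A73 PROVED AWAY
# (cell `b2b-bsdres`, team n1011, seat p16 GEN 11; lead R5-87 (e) (W2) = additive-p4 GEN 23 word: the
# UPPER / two-sided no-Milne twins of the additive-p4 ℚ(ζ₃) lines are the p16 lineage's; row T-MIL-CAN)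

HONEST FRAMING (cell `b2b-bsdres`, run/shared/lean/b2b/bsd-rank1-residual/, verbatim in every
file): the goal of the cell is to DELETE the COMBINATION-SHAPED residual classes of the
Birch–Swinnerton-Dyer formula for ALL analytic-rank `≤ 1` elliptic curves over `ℚ` — "full BSD
formula for every rank `≤ 1` curve in class `C`" assembled STRICTLY from published theorems — so
that the rank-`≤ 1` remainder becomes exactly the CONSTRUCTION-SHAPED classes, which are TYPED
(missing-input `Prop`s), NOT attempted. This is not "finishing BSD". Team n1011 (N10 / N11), seat p16:
research route; X1 / X3 / X4 / X10 / N10 / N11 labels and marks UNCHANGED; nothing booked. Theorems only.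

This file is `X3RankZeroCyclotomicThreeFacts.lean` (mathematics, census and references in THAT file's docstrings,
unchanged) with the Milne binder `hMilne : Milne1972.bsdQuotient_baseChange_quadratic_anyModel` (A73)
DELETED from every Milne-binding theorem and NOTHING added: each such theorem is re-issued under its name
with the suffix `_noMilne`, every other binder and every proof line byte-identical, every call to a
Milne-binding tree theorem redirected to its no-Milne twin (`…_noLocal` cores / `…_noMilne` Facts of the
p16 lineage); Milne-free helpers of the source file are used as landed, not re-declared. What the
additive-p4 cores read from A73 — `Ш(V_K)` finite and the `3`-adic valuation of the card identity over
`K = ℚ(ζ₃)` — are the THEOREMS `shaFinite_baseChange_of_twist` and T-MIL-CAN FILE 4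
`padicVal_card_identity_baseChange[_anyRank]_of_natAbs_discr_eq` (`|d_K| = 3`, `V` good or multiplicative
at `3`: the per-place fibre identities (T) at EVERY place — n1011-p01's T-MIL-3 H-5a with rows T-MIL-B2 /
T-A233 inside). Every other displayed hypothesis (named facts, (⊇/K) where present, census bits,
certificates) is exactly the source file's. Labels UNCHANGED; nothing booked; no mark moves.
-/

noncomputable section

open scoped Classical MatrixGroups ModularForm

open CongruenceSubgroup WeierstrassCurve NumberField IsDedekindDomain
  Literature.NumberTheory.EllipticCurves Literature.NumberTheory.EllipticCurves.ModularForms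
  Literature.NumberTheory.EllipticCurves.Rank1Residual
  Literature.NumberTheory.EllipticCurves.Rank1Residual.Typed
  Literature.NumberTheory.GaloisRepresentations

namespace Summit.BirchSwinnertonDyer.Rank1Residual.Additive

/-! ## §1 `hGrK` from Greenberg's Theorem 4.1 over number fields -/

section GreenbergK

variable (K : Type) [Field K] [NumberField K] [IsCyclotomicExtension {3} ℚ K]
  (V : WeierstrassCurve ℚ) [V.IsElliptic] [V.IsGloballyMinimal]

end GreenbergK

/-! ## §2 Line V14 from named facts only (the auxiliary field instantiated as `CyclotomicField 3 ℚ`) -/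

section Facts

variable (V : WeierstrassCurve ℚ) [V.IsElliptic] [V.IsGloballyMinimal]
  (W : WeierstrassCurve ℚ) [W.IsElliptic] [W.IsGloballyMinimal]

/-- **Line V14, core inequality, from named facts only.** Let `V/ℚ` be globally minimal, good ORDINARY
at `3` with `V[3]` REDUCIBLE, and `W = C • V^{(−3)}` a globally minimal model of its twist by `−3`,
ADDITIVE at `3` (the X3 ∧ (G-ord, `e = 2`) situation at `p = 3`), both of analytic rank `0`. Then
`#Ш_an(V) = q_V` and `#Ш_an(W) = q_W` are rationals with
**`ord₃ #Ш(V) + ord₃ #Ш(W) ≤ ord₃ q_V + ord₃ q_W`**, granted EXACTLY the published inputs: Wuthrich 2014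
Thm. 16 at `p = 3` over `ℚ(ζ₃)` (`hW16`, named fact), Greenberg 1999 Thm. 4.1 over number fields
(`hGr`, named fact), modularity (`hmod`, `hmodD`) and Gross–Zagier–Kolyvagin (`hGZK`). The cyclotomic setting over
`K = ℚ(ζ₃)` (former `hexK`), the odd-branch constant term (former `hD1`) and the `K`-shape of
Greenberg's theorem (former `hGrK`) are THEOREMS; `K` is instantiated as `CyclotomicField 3 ℚ`.
Mathematics: docstring of `X3CyclotomicThree.exists_padicVal_shaOrder_add_le_noLocal`.
[cite: Wuthrich2014, Thm. 16 (p. 397)] [cite: GreenbergLNM1716, Thm. 4.1 (p. 102)]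
[cite: Milne1972ArithmeticAV, §1 Thm. 1 and §2 (through DokchitserDokchitserAnnals2010, §2.1, proof of Thm. 8)] -/
theorem X3CyclotomicThree.exists_padicVal_shaOrder_add_le_of_facts_noMilne
    (hW16 : Wuthrich2014.charIdeal_dvd_padicLFunction_cyclotomicThree)
    (hGr : Greenberg1999.thm41_charValue_rankZero_numberField)
    (hGZK : rank_eq_analyticRank_of_analyticRank_le_one) (hmod : hasEntireLFunction_rat)
    (hmodD : nonempty_modularParametrizationData)
    (C : VariableChange ℚ) (hC : C • V.quadraticTwist (-(3 : ℚ)) = W)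
    (hord : IsOrdinaryAt V 3) (hred : ¬ V.HasIrreducibleModPGaloisRep 3) (hadd : Addv W 3)
    (hrV : V.analyticRank = 0) (hrW : W.analyticRank = 0) :
    ∃ qV qW : ℚ, shaAn V = (qV : ℂ) ∧ shaAn W = (qW : ℂ) ∧
      (padicValNat 3 V.shaOrder : ℤ) + padicValNat 3 W.shaOrder ≤ padicValRat 3 qV + padicValRat 3 qW := by
  haveI : IsCyclotomicExtension {3} ℚ (CyclotomicField 3 ℚ) := CyclotomicField.isCyclotomicExtension 3 ℚ
  exact X3CyclotomicThree.exists_padicVal_shaOrder_add_le_of_fact_noMilne (CyclotomicField 3 ℚ) V W hW16 hGZK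
    hmod hmodD C hC hord hred hadd hrV hrW
    (exists_isCyclotomic_isTopGenerator_cyclotomicThree (CyclotomicField 3 ℚ))
    (X3CyclotomicThree.greenbergK_of_fact (CyclotomicField 3 ℚ) V hGr hord)

/-- **The cell's typed UPPER half for the additive curve, from named facts only.** In the situation
of `X3CyclotomicThree.exists_padicVal_shaOrder_add_le_of_facts_noMilne`, if `#Ш_an(V)` has non-positive
`3`-adic valuation (e.g. `3 ∤ #Ш_an(V)`, a census bit of the TWIST pair), then
`ord₃ #Ш(W) ≤ ord₃ #Ш_an(W)`, i.e. `Typed.MissingUpperBoundAt W 3`.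
[cite: Wuthrich2014, Thm. 16 (p. 397)] [cite: GreenbergLNM1716, Thm. 4.1 (p. 102)] -/
theorem X3CyclotomicThree.missingUpperBoundAt_of_facts_noMilne
    (hW16 : Wuthrich2014.charIdeal_dvd_padicLFunction_cyclotomicThree)
    (hGr : Greenberg1999.thm41_charValue_rankZero_numberField)
    (hGZK : rank_eq_analyticRank_of_analyticRank_le_one) (hmod : hasEntireLFunction_rat)
    (hmodD : nonempty_modularParametrizationData)
    (C : VariableChange ℚ) (hC : C • V.quadraticTwist (-(3 : ℚ)) = W)
    (hord : IsOrdinaryAt V 3) (hred : ¬ V.HasIrreducibleModPGaloisRep 3) (hadd : Addv W 3)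
    (hrV : V.analyticRank = 0) (hrW : W.analyticRank = 0)
    {qV : ℚ} (hqV : shaAn V = (qV : ℂ)) (hv : padicValRat 3 qV ≤ 0) :
    MissingUpperBoundAt W 3 := by
  obtain ⟨qV', qW, hqV', hqW, hle⟩ := X3CyclotomicThree.exists_padicVal_shaOrder_add_le_of_facts_noMilne V W
    hW16 hGr hGZK hmod hmodD C hC hord hred hadd hrV hrW
  have hqq : qV' = qV := by exact_mod_cast hqV'.symm.trans hqV
  subst hqq
  refine ⟨qW, hqW, ?_⟩
  have h0 : (0 : ℤ) ≤ padicValNat 3 V.shaOrder := by positivity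
  linarith

/-- **`BSD(W,3) ∧ BSD(V,3)` on the doubly-unit rows, from named facts only.** In the situation of
`X3CyclotomicThree.exists_padicVal_shaOrder_add_le_of_facts_noMilne`, if `#Ш_an(V)` and `#Ш_an(W)` are
`3`-adic units then Miller's `BSD(W,3)` and `BSD(V,3)` hold — for the ADDITIVE X3 pair `(W,3)` (type
`I₀*`, `W[3]` reducible) and its good ordinary Eisenstein twist pair `(V,3)` simultaneously. Census
(cell, N < 2·10⁴): 78 of the 79 CORE-open rank-`(0,0)` X3 ∧ (G-ord, `e = 2`) pairs at `p = 3` are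
doubly-unit. Inputs: three named published facts (`hW16`, `hGr`; NO Milne), modularity (`hmod`,
`hmodD`), GZK (`hGZK`) — nothing else. Labels UNCHANGED; nothing booked by this theorem.
[cite: Wuthrich2014, Thm. 16 (p. 397)] [cite: GreenbergLNM1716, Thm. 4.1 (p. 102)]
[cite: Milne1972ArithmeticAV, §1 Thm. 1 and §2 (through DokchitserDokchitserAnnals2010, §2.1, proof of Thm. 8)] -/
theorem X3CyclotomicThree.bsdp_of_shaAn_units_of_facts_noMilne
    (hW16 : Wuthrich2014.charIdeal_dvd_padicLFunction_cyclotomicThree)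
    (hGr : Greenberg1999.thm41_charValue_rankZero_numberField)
    (hGZK : rank_eq_analyticRank_of_analyticRank_le_one) (hmod : hasEntireLFunction_rat)
    (hmodD : nonempty_modularParametrizationData)
    (C : VariableChange ℚ) (hC : C • V.quadraticTwist (-(3 : ℚ)) = W)
    (hord : IsOrdinaryAt V 3) (hred : ¬ V.HasIrreducibleModPGaloisRep 3) (hadd : Addv W 3)
    (hrV : V.analyticRank = 0) (hrW : W.analyticRank = 0)
    {qV qW : ℚ} (hqV : shaAn V = (qV : ℂ)) (hqW : shaAn W = (qW : ℂ))
    (hvV : padicValRat 3 qV = 0) (hvW : padicValRat 3 qW = 0) : BSDp W 3 ∧ BSDp V 3 := by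
  haveI : IsCyclotomicExtension {3} ℚ (CyclotomicField 3 ℚ) := CyclotomicField.isCyclotomicExtension 3 ℚ
  exact X3CyclotomicThree.bsdp_of_shaAn_units_of_fact_noMilne (CyclotomicField 3 ℚ) V W hW16 hGZK hmod hmodD
    C hC hord hred hadd hrV hrW
    (exists_isCyclotomic_isTopGenerator_cyclotomicThree (CyclotomicField 3 ℚ))
    (X3CyclotomicThree.greenbergK_of_fact (CyclotomicField 3 ℚ) V hGr hord) hqV hqW hvV hvW

/-- **The `3 ∣ #Ш_an(W)` rows: `BSD(W,3)` from ONE finite certificate, named facts otherwise**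
(X3 ∧ (G-ord, `e = 2`) ∧ `p = 3` ∧ ranks `(0,0)`, `3 ∤ #Ш_an(V)`). If `#Ш_an(W) = q` with
`ord₃ q ≤ 2k` and `3^{2k−1} ∣ #Ш(W)` (for `k = 1`: `Ш(W)[3] ≠ 0`, a `3`-descent certificate), then
`BSD(W,3)`: the upper half is `X3CyclotomicThree.missingUpperBoundAt_of_facts_noMilne`, the lower half is
Cassels–Tate squareness (`hCT` = bsd.S18, `missingLowerBoundAt_of_casselsTate_of_pow_dvd`). Census
(hyp v14/V14-CENSUS.md, two engines): the only rank-`(0,0)` row with `3 ∣ #Ш_an(W)` is 7632m1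
(`#Ш_an = 9`, `k = 1`; sha-2 certifies `Ш(W)[3] ≠ 0`). Nothing booked by this theorem.
[cite: Wuthrich2014, Thm. 16 (p. 397)] [cite: GreenbergLNM1716, Thm. 4.1 (p. 102)]
[cite: SilvermanAEC2009, Thm. X.4.14] [cite: Miller2011LMS, §1 and Def. 1.1] -/
theorem X3CyclotomicThree.bsdp_of_casselsTate_of_pow_dvd_of_facts_noMilne
    (hW16 : Wuthrich2014.charIdeal_dvd_padicLFunction_cyclotomicThree)
    (hGr : Greenberg1999.thm41_charValue_rankZero_numberField)
    (hGZK : rank_eq_analyticRank_of_analyticRank_le_one) (hmod : hasEntireLFunction_rat)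
    (hmodD : nonempty_modularParametrizationData) (hCT : exists_casselsTate_pairing (K := ℚ))
    (C : VariableChange ℚ) (hC : C • V.quadraticTwist (-(3 : ℚ)) = W)
    (hord : IsOrdinaryAt V 3) (hred : ¬ V.HasIrreducibleModPGaloisRep 3) (hadd : Addv W 3)
    (hrV : V.analyticRank = 0) (hrW : W.analyticRank = 0)
    {qV : ℚ} (hqV : shaAn V = (qV : ℂ)) (hvV : padicValRat 3 qV ≤ 0)
    {q : ℚ} (hq : shaAn W = (q : ℂ)) {k : ℕ} (hv : padicValRat 3 q ≤ 2 * k)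
    (hdvd : 3 ^ (2 * k - 1) ∣ W.shaOrder) : BSDp W 3 :=
  bsdp_of_missingPPartAt W 3 hGZK (by rw [hrW]; exact zero_le_one)
    (missingPPartAt_of_lower_of_upper W 3
      (missingLowerBoundAt_of_casselsTate_of_pow_dvd W 3 hCT (hGZK W (by rw [hrW]; exact zero_le_one)).2
        hq hv hdvd)
      (X3CyclotomicThree.missingUpperBoundAt_of_facts_noMilne V W hW16 hGr hGZK hmod hmodD C hC hord hred
        hadd hrV hrW hqV hvV))

end Facts

end Summit.BirchSwinnertonDyer.Rank1Residual.Additive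

end
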